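import Summits.Ventures.Crystal3D.Theorems.StickyWulffConstantCoaxialWallLawBarlowWindowHeights
import HarnessLib

/-!
# The dozen of an interior Barlow site READ BY THE AUTOMATON: full at c-layers, twin readings at h-layers (F_layer L2/L3 brick)

HONEST FRAMING. Venture `Summits/Ventures/Crystal3D` (cell `crystal3d-full`); helper for the crux `CoaxialWallLaw`
(stmt-Ventures-19481, line `WallLedgerF`) in its role as owner of lane T's debt T-F2 / F_layer (cf-p1 DECISIONS (lxxiii), (lxxx),
(lxxxiii); sizing memo HOME/wall-19481-p1/T-F2-n3.md §3 (L2)/(L3)).  Census-free lattice bookkeeping, standard axioms; nothing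
about the crux or the stubs is claimed; F-C1 not moved.  The FORWARD counterpart of 19481-p2's frame/rigidity lemmas
(`frame_of_isFull_barlow`, `far_slot_not_site_barlow`, …BarlowWindowFrames/…TwinReadings): in MODEL coordinates, at a site
`q = barlowPos 1 √(2/3) s k i j` of a Barlow stacking whose twelve stacking neighbours are occupied (`hnb`) and whose occupied
unit sphere lies on the stacking (`hX`, the hypothesis of …TwinReadings), the automaton READS:

* `barlowSite_add_offset` (site arithmetic), `barlowSite_add_slot_mem_inPlane / _up / _down`, `barlowSite_add_mirrorSlot_mem_up /
  _down` — which slot / mirror-slot steps from `q` land on sites, by the letters `s (k−1)`, `s k`;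
* `barlowSite_add_upSlot_not_mem` / `…downSlot_not_mem` — the converse (letter mismatch ⇒ the slot position is EMPTY, via
  19481-p2's `neighbour_up_mem` / `neighbour_down_mem`);
* **`isFull_barlowSite`** (`s (k−1) = s k = 1` ⇒ `IsFull X (refl) q`), **`isFull_mirror_barlowSite`** (`= −1, −1` ⇒ `IsFull X basalMirror q`),
  **`isTwinReading_barlowSite_up`** (`s (k−1) = 1, s k = −1` ⇒ `IsTwinReading X (refl) e₃ q`), **`isTwinReading_barlowSite_down`**
  (`s (k−1) = −1, s k = 1` ⇒ `IsTwinReading X (refl) (−e₃) q`).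
So every interior ball of a Barlow PLATE is MOVING for the in-plane roots (full move at c-layers, glide at h-layers): the source
condition of the per-strip word nets (F_layer L2), and the absorber structure of a Barlow top plate (L3).
WHAT THIS IS NOT: no walker count, no wall inequality; F-C1 not moved.
-/

noncomputable section

namespace Summit.Ventures.Crystal3D.Theorems

open Summit.Ventures.Crystal3D Finset
open Literature.MathematicalPhysics.StatisticalMechanics (barlowPos barlowStacking fccStacking constHagg IsHaggSeq
  haggLabel haggLabel_succ haggLabel_const basalMirror basalMirror_barlowPos_constHagg basalMirror_apply_coord
  triangularVec₁ triangularVec₂ barlowOffset layerNormal barlowPos_apply_two barlowPos_mem)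
open scoped InnerProductSpace

/-! ### Site arithmetic -/

/-- **Site arithmetic**: adding the offset `c₂ u + c₃ v + ℓ w + ε h e₃` to the site `(k, i, j)` lands on the site
`(k + ε, i + c₂, j + c₃)` as soon as the labels match, `L (k + ε) = L k + ℓ`. -/
theorem barlowSite_add_offset (s : ℤ → ℤ) (k i j ℓ ε c₂ c₃ : ℤ) (hlab : haggLabel s (k + ε) = haggLabel s k + ℓ) :
    barlowPos 1 (Real.sqrt (2 / 3)) s k i j +
        ((c₂ : ℝ) • triangularVec₁ 1 + (c₃ : ℝ) • triangularVec₂ 1 + (ℓ : ℝ) • barlowOffset 1 +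
          (ε : ℝ) • layerNormal (Real.sqrt (2 / 3))) =
      barlowPos 1 (Real.sqrt (2 / 3)) s (k + ε) (i + c₂) (j + c₃) := by
  simp only [barlowPos, hlab]
  push_cast
  module

/-- The basal mirror of a model slot, in the offset form (label `c₁`, layer `−c₁`). -/
theorem basalMirror_slot_eq_offset (c : ℤ × ℤ × ℤ) :
    basalMirror (barlowPos 1 (Real.sqrt (2 / 3)) constHagg c.1 c.2.1 c.2.2) =
      (c.2.1 : ℝ) • triangularVec₁ 1 + (c.2.2 : ℝ) • triangularVec₂ 1 + (c.1 : ℝ) • barlowOffset 1 +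
        ((-c.1 : ℤ) : ℝ) • layerNormal (Real.sqrt (2 / 3)) := by
  rw [basalMirror_barlowPos_constHagg]
  push_cast
  module

/-- The first coordinate of a slot triple is `−1`, `0` or `1`, and it is the slot's height in units of `√(2/3)`. -/
theorem fccSlotTriples_fst {c : ℤ × ℤ × ℤ} (hc : c ∈ fccSlotTriples) : c.1 = -1 ∨ c.1 = 0 ∨ c.1 = 1 := by
  simp only [fccSlotTriples, mem_insert, mem_singleton] at hc
  rcases hc with rfl | rfl | rfl | rfl | rfl | rfl | rfl | rfl | rfl | rfl | rfl | rfl <;> simp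

/-- Height of a slot in terms of its triple. -/
theorem slot_apply_two_eq (c : ℤ × ℤ × ℤ) :
    (barlowPos 1 (Real.sqrt (2 / 3)) constHagg c.1 c.2.1 c.2.2) 2 = (c.1 : ℝ) * Real.sqrt (2 / 3) :=
  barlowPos_apply_two _ _ _ _ _ _

section Site

variable {s : ℤ → ℤ} (hs : IsHaggSeq s) (k i j : ℤ)

/-- Positivity of the layer spacing. -/
private theorem hB_pos : (0 : ℝ) < Real.sqrt (2 / 3) := Real.sqrt_pos.2 (by norm_num)

/-! ### Which slot steps land on sites -/

/-- The letter-indexed site condition for a slot step `q + w`, `w` the slot with triple `c`: in-plane always; up iff `s k = 1`;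
down iff `s (k−1) = 1`. -/
theorem barlowSite_add_slot_mem {c : ℤ × ℤ × ℤ} (hc : c ∈ fccSlotTriples)
    (hletter : c.1 = 0 ∨ (c.1 = 1 ∧ s k = 1) ∨ (c.1 = -1 ∧ s (k - 1) = 1)) :
    barlowPos 1 (Real.sqrt (2 / 3)) s k i j + barlowPos 1 (Real.sqrt (2 / 3)) constHagg c.1 c.2.1 c.2.2 ∈
      barlowStacking 1 (Real.sqrt (2 / 3)) s := by
  have _ := hc
  rw [barlowPos_constHagg_eq]
  have hlab : haggLabel s (k + c.1) = haggLabel s k + c.1 := by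
    rcases hletter with h0 | ⟨h1, hsk⟩ | ⟨h1, hsk⟩
    · rw [h0, add_zero, add_zero]
    · rw [h1, haggLabel_succ, hsk]
    · rw [h1]
      have := haggLabel_succ s (k + -1)
      rw [show k + -1 + 1 = k by ring, show k + -1 = k - 1 by ring, hsk] at this
      rw [show k + -1 = k - 1 by ring]; linarith
  rw [barlowSite_add_offset s k i j c.1 c.1 c.2.1 c.2.2 hlab]
  exact barlowPos_mem _ _ _

/-- The letter-indexed site condition for a MIRROR-slot step `q + M w`, `w` the slot with triple `c` (`M` the basal mirror):
in-plane always; `c.1 = −1` (so `M w` points up) iff `s k = −1`; `c.1 = 1` (`M w` points down) iff `s (k−1) = −1`. -/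
theorem barlowSite_add_mirrorSlot_mem {c : ℤ × ℤ × ℤ} (hc : c ∈ fccSlotTriples)
    (hletter : c.1 = 0 ∨ (c.1 = -1 ∧ s k = -1) ∨ (c.1 = 1 ∧ s (k - 1) = -1)) :
    barlowPos 1 (Real.sqrt (2 / 3)) s k i j + basalMirror (barlowPos 1 (Real.sqrt (2 / 3)) constHagg c.1 c.2.1 c.2.2) ∈
      barlowStacking 1 (Real.sqrt (2 / 3)) s := by
  have _ := hc
  rw [basalMirror_slot_eq_offset]
  have hlab : haggLabel s (k + -c.1) = haggLabel s k + c.1 := by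
    rcases hletter with h0 | ⟨h1, hsk⟩ | ⟨h1, hsk⟩
    · rw [h0, neg_zero, add_zero, add_zero]
    · rw [h1, neg_neg, haggLabel_succ, hsk]
    · rw [h1]
      have := haggLabel_succ s (k + -1)
      rw [show k + -1 + 1 = k by ring, show k + -1 = k - 1 by ring, hsk] at this
      rw [show k + -1 = k - 1 by ring]; linarith
  rw [barlowSite_add_offset s k i j c.1 (-c.1) c.2.1 c.2.2 hlab]
  exact barlowPos_mem _ _ _

/-! ### Which slot positions are empty (letter mismatch) -/

variable {X : Finset (EuclideanSpace ℝ (Fin 3))}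
  (hX : ∀ x ∈ X, dist (barlowPos 1 (Real.sqrt (2 / 3)) s k i j) x = 1 → x ∈ barlowStacking 1 (Real.sqrt (2 / 3)) s)

include hs hX

/-- **An UP slot position of the identity dozen is EMPTY when `s k = −1`.** -/
theorem barlowSite_add_upSlot_not_mem (hsk : s k = -1) {w : EuclideanSpace ℝ (Fin 3)} (hw : w ∈ fccSlots)
    (hup : 0 < w 2) : barlowPos 1 (Real.sqrt (2 / 3)) s k i j + w ∉ X := by
  classical
  intro hmem
  have hw1 : ‖w‖ = 1 := norm_eq_one_of_mem_fccSlots hw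
  have hd : dist (barlowPos 1 (Real.sqrt (2 / 3)) s k i j) (barlowPos 1 (Real.sqrt (2 / 3)) s k i j + w) = 1 := by
    rw [dist_eq_norm, sub_add_cancel_left, norm_neg, hw1]
  obtain ⟨k', i', j', hk'⟩ := hX _ hmem hd
  -- the layer of `q + w` is `k + 1`
  obtain ⟨c, hc, rfl⟩ := mem_image.1 hw
  have hc1 : c.1 = 1 := by
    have h2 := slot_apply_two_eq c
    rcases fccSlotTriples_fst hc with h | h | h
    · rw [h2, h] at hup; have := hB_pos; push_cast at hup; nlinarith
    · rw [h2, h] at hup; simp at hup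
    · exact h
  have hlay : k' = k + 1 := by
    have h := congrArg (fun x : EuclideanSpace ℝ (Fin 3) => x 2) hk'
    simp only [PiLp.add_apply, barlowPos_apply_two, hc1] at h
    push_cast at h
    have : ((k : ℝ) + 1) * Real.sqrt (2 / 3) = (k' : ℝ) * Real.sqrt (2 / 3) := by linarith
    have := mul_right_cancel₀ hB_pos.ne' this
    exact_mod_cast this.symm
  subst hlay
  have hd' : dist (barlowPos 1 (Real.sqrt (2 / 3)) s k i j) (barlowPos 1 (Real.sqrt (2 / 3)) s (k + 1) i' j') = 1 := by
    rw [← hk']; exact hd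
  rcases neighbour_up_mem hs k i j i' j' hd' with ⟨h1, -⟩ | ⟨-, -, hnot⟩
  · rw [hsk] at h1; norm_num at h1
  · apply hnot
    rw [← hk', add_sub_cancel_left]
    exact mem_image.2 ⟨c, hc, rfl⟩

/-- **A DOWN slot position of the identity dozen is EMPTY when `s (k−1) = −1`.** -/
theorem barlowSite_add_downSlot_not_mem (hsk : s (k - 1) = -1) {w : EuclideanSpace ℝ (Fin 3)} (hw : w ∈ fccSlots)
    (hdown : w 2 < 0) : barlowPos 1 (Real.sqrt (2 / 3)) s k i j + w ∉ X := by
  classical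
  intro hmem
  have hw1 : ‖w‖ = 1 := norm_eq_one_of_mem_fccSlots hw
  have hd : dist (barlowPos 1 (Real.sqrt (2 / 3)) s k i j) (barlowPos 1 (Real.sqrt (2 / 3)) s k i j + w) = 1 := by
    rw [dist_eq_norm, sub_add_cancel_left, norm_neg, hw1]
  obtain ⟨k', i', j', hk'⟩ := hX _ hmem hd
  obtain ⟨c, hc, rfl⟩ := mem_image.1 hw
  have hc1 : c.1 = -1 := by
    have h2 := slot_apply_two_eq c
    rcases fccSlotTriples_fst hc with h | h | h
    · exact h
    · rw [h2, h] at hdown; simp at hdown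
    · rw [h2, h] at hdown; have := hB_pos; push_cast at hdown; nlinarith
  have hlay : k' = k - 1 := by
    have h := congrArg (fun x : EuclideanSpace ℝ (Fin 3) => x 2) hk'
    simp only [PiLp.add_apply, barlowPos_apply_two, hc1] at h
    push_cast at h
    have : ((k : ℝ) - 1) * Real.sqrt (2 / 3) = (k' : ℝ) * Real.sqrt (2 / 3) := by linarith
    have := mul_right_cancel₀ hB_pos.ne' this
    have : (k' : ℤ) = k - 1 := by exact_mod_cast this.symm
    exact this
  subst hlay
  have hd' : dist (barlowPos 1 (Real.sqrt (2 / 3)) s k i j) (barlowPos 1 (Real.sqrt (2 / 3)) s (k - 1) i' j') = 1 := by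
    rw [← hk']; exact hd
  rcases neighbour_down_mem hs k i j i' j' hd' with ⟨h1, -⟩ | ⟨-, -, hnot⟩
  · rw [hsk] at h1; norm_num at h1
  · apply hnot
    rw [← hk', add_sub_cancel_left]
    exact mem_image.2 ⟨c, hc, rfl⟩

/-! ### The readings -/

omit hX in
/-- The identity frame with normal `±e₃` is a menu normal pair. -/
theorem isMenuNormal_refl_e₃ (ε : ℝ) (hε : ε = 1 ∨ ε = -1) :
    IsMenuNormal (LinearIsometryEquiv.refl ℝ (EuclideanSpace ℝ (Fin 3))) (ε • EuclideanSpace.single (2 : Fin 3) (1 : ℝ)) := by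
  have _ := hs
  refine ⟨?_, fun w hw => ?_⟩
  · rw [norm_smul, PiLp.norm_single, norm_one, mul_one]
    rcases hε with rfl | rfl <;> simp
  · rw [LinearIsometryEquiv.coe_refl, id, inner_smul_right, ← apply_two_eq_inner_e₃]
    rcases slot_apply_two_cases hw with h | h | h <;> rcases hε with rfl | rfl <;> rw [h] <;> norm_num

variable (hnb : ∀ x ∈ barlowStacking 1 (Real.sqrt (2 / 3)) s, dist (barlowPos 1 (Real.sqrt (2 / 3)) s k i j) x = 1 → x ∈ X)
include hnb

omit hs hX in
/-- A site neighbour reached by a unit step is occupied. -/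
theorem barlowSite_step_mem_X {y : EuclideanSpace ℝ (Fin 3)} (hy : ‖y‖ = 1)
    (hsite : barlowPos 1 (Real.sqrt (2 / 3)) s k i j + y ∈ barlowStacking 1 (Real.sqrt (2 / 3)) s) :
    barlowPos 1 (Real.sqrt (2 / 3)) s k i j + y ∈ X :=
  hnb _ hsite (by rw [dist_eq_norm, sub_add_cancel_left, norm_neg, hy])

omit hs hX in
/-- **c-LAYER, letter `+`: the identity dozen is FULL** (`s (k−1) = s k = 1`). -/
theorem isFull_barlowSite (h₁ : s (k - 1) = 1) (h₂ : s k = 1) :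
    IsFull X (LinearIsometryEquiv.refl ℝ (EuclideanSpace ℝ (Fin 3))) (barlowPos 1 (Real.sqrt (2 / 3)) s k i j) := by
  classical
  intro w hw
  rw [LinearIsometryEquiv.coe_refl, id]
  obtain ⟨c, hc, rfl⟩ := mem_image.1 hw
  refine barlowSite_step_mem_X k i j hnb (norm_eq_one_of_mem_fccSlots hw) (barlowSite_add_slot_mem k i j hc ?_)
  rcases fccSlotTriples_fst hc with h | h | h
  · exact Or.inr (Or.inr ⟨h, h₁⟩)
  · exact Or.inl h
  · exact Or.inr (Or.inl ⟨h, h₂⟩)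

omit hs hX in
/-- **c-LAYER, letter `−`: the MIRROR dozen is FULL** (`s (k−1) = s k = −1`). -/
theorem isFull_mirror_barlowSite (h₁ : s (k - 1) = -1) (h₂ : s k = -1) :
    IsFull X basalMirror (barlowPos 1 (Real.sqrt (2 / 3)) s k i j) := by
  classical
  intro w hw
  obtain ⟨c, hc, rfl⟩ := mem_image.1 hw
  refine barlowSite_step_mem_X k i j hnb (by rw [LinearIsometryEquiv.norm_map, norm_eq_one_of_mem_fccSlots hw])
    (barlowSite_add_mirrorSlot_mem k i j hc ?_)
  rcases fccSlotTriples_fst hc with h | h | h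
  · exact Or.inr (Or.inl ⟨h, h₂⟩)
  · exact Or.inl h
  · exact Or.inr (Or.inr ⟨h, h₁⟩)

/-- **h-LAYER `(+, −)`: the identity dozen reads a TWIN with normal `e₃`** (`s (k−1) = 1`, `s k = −1`): the lower closed half-dozen
and the three mirror balls are occupied, the three upper slots are empty. -/
theorem isTwinReading_barlowSite_up (h₁ : s (k - 1) = 1) (h₂ : s k = -1) :
    IsTwinReading X (LinearIsometryEquiv.refl ℝ (EuclideanSpace ℝ (Fin 3))) (EuclideanSpace.single (2 : Fin 3) (1 : ℝ))
      (barlowPos 1 (Real.sqrt (2 / 3)) s k i j) := by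
  classical
  have hmenu := isMenuNormal_refl_e₃ hs 1 (Or.inl rfl)
  rw [one_smul] at hmenu
  refine ⟨hmenu, fun w hw hle => ?_, fun w hw hlt => ?_, fun w hw hpos => ?_⟩
  · -- lower closed half: in-plane or down slots, sites by `s (k−1) = 1`
    rw [LinearIsometryEquiv.coe_refl, id] at hle ⊢
    rw [← apply_two_eq_inner_e₃] at hle
    obtain ⟨c, hc, rfl⟩ := mem_image.1 hw
    refine barlowSite_step_mem_X k i j hnb (norm_eq_one_of_mem_fccSlots hw) (barlowSite_add_slot_mem k i j hc ?_)
    rcases fccSlotTriples_fst hc with h | h | h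
    · exact Or.inr (Or.inr ⟨h, h₁⟩)
    · exact Or.inl h
    · exfalso; rw [slot_apply_two_eq, h] at hle; have := hB_pos; push_cast at hle; linarith
  · -- mirror balls of the down slots: up positions with label `−1`, sites by `s k = −1`
    rw [LinearIsometryEquiv.coe_refl, id] at hlt ⊢
    rw [← basalMirror_apply_eq]
    rw [← apply_two_eq_inner_e₃] at hlt
    obtain ⟨c, hc, rfl⟩ := mem_image.1 hw
    refine barlowSite_step_mem_X k i j hnb (by rw [LinearIsometryEquiv.norm_map, norm_eq_one_of_mem_fccSlots hw])
      (barlowSite_add_mirrorSlot_mem k i j hc ?_)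
    rcases fccSlotTriples_fst hc with h | h | h
    · exact Or.inr (Or.inl ⟨h, h₂⟩)
    · exfalso; rw [slot_apply_two_eq, h] at hlt; simp at hlt
    · exfalso; rw [slot_apply_two_eq, h] at hlt; have := hB_pos; push_cast at hlt; linarith
  · -- far slots: up slots, empty by `s k = −1`
    rw [LinearIsometryEquiv.coe_refl, id] at hpos ⊢
    rw [← apply_two_eq_inner_e₃] at hpos
    exact barlowSite_add_upSlot_not_mem hs k i j hX h₂ hw hpos

/-- **h-LAYER `(−, +)`: the identity dozen reads a TWIN with normal `−e₃`** (`s (k−1) = −1`, `s k = 1`). -/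
theorem isTwinReading_barlowSite_down (h₁ : s (k - 1) = -1) (h₂ : s k = 1) :
    IsTwinReading X (LinearIsometryEquiv.refl ℝ (EuclideanSpace ℝ (Fin 3))) (-EuclideanSpace.single (2 : Fin 3) (1 : ℝ))
      (barlowPos 1 (Real.sqrt (2 / 3)) s k i j) := by
  classical
  have hmenu := isMenuNormal_refl_e₃ hs (-1) (Or.inr rfl)
  rw [neg_one_smul] at hmenu
  refine ⟨hmenu, fun w hw hle => ?_, fun w hw hlt => ?_, fun w hw hpos => ?_⟩
  · rw [LinearIsometryEquiv.coe_refl, id] at hle ⊢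
    rw [inner_neg_right, ← apply_two_eq_inner_e₃] at hle
    obtain ⟨c, hc, rfl⟩ := mem_image.1 hw
    refine barlowSite_step_mem_X k i j hnb (norm_eq_one_of_mem_fccSlots hw) (barlowSite_add_slot_mem k i j hc ?_)
    rcases fccSlotTriples_fst hc with h | h | h
    · exfalso; rw [slot_apply_two_eq, h] at hle; have := hB_pos; push_cast at hle; linarith
    · exact Or.inl h
    · exact Or.inr (Or.inl ⟨h, h₂⟩)
  · rw [LinearIsometryEquiv.coe_refl, id] at hlt ⊢
    rw [inner_neg_right, ← apply_two_eq_inner_e₃] at hlt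
    have hmir : w - (2 * ⟪w, -EuclideanSpace.single (2 : Fin 3) (1 : ℝ)⟫_ℝ) • -EuclideanSpace.single (2 : Fin 3) (1 : ℝ) =
        basalMirror w := by
      rw [basalMirror_apply_eq, inner_neg_right]; module
    rw [hmir]
    obtain ⟨c, hc, rfl⟩ := mem_image.1 hw
    refine barlowSite_step_mem_X k i j hnb (by rw [LinearIsometryEquiv.norm_map, norm_eq_one_of_mem_fccSlots hw])
      (barlowSite_add_mirrorSlot_mem k i j hc ?_)
    rcases fccSlotTriples_fst hc with h | h | h
    · exfalso; rw [slot_apply_two_eq, h] at hlt; have := hB_pos; push_cast at hlt; linarith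
    · exfalso; rw [slot_apply_two_eq, h] at hlt; simp at hlt
    · exact Or.inr (Or.inr ⟨h, h₁⟩)
  · rw [LinearIsometryEquiv.coe_refl, id] at hpos ⊢
    rw [inner_neg_right, ← apply_two_eq_inner_e₃] at hpos
    exact barlowSite_add_downSlot_not_mem hs k i j hX h₁ hw (by linarith)

end Site

end Summit.Ventures.Crystal3D.Theorems

end
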